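import Mathlib
import Summits.Ventures.PercRepro2.Defs
import Summits.Ventures.PercRepro2.Independence
import Summits.Ventures.PercRepro2.Harris
import Summits.Ventures.PercRepro2.Graph
import Summits.Ventures.PercRepro2.Exploration
import Summits.Ventures.PercRepro2.Events
import Summits.Ventures.PercRepro2.CDRequired
import Summits.Ventures.PercRepro2.CutVertexDefs
import Summits.Ventures.PercRepro2.CDCutVertex
import Summits.Ventures.PercRepro2.CDCutAC
import Summits.Ventures.PercRepro2.CDNestedAC

/-!
# Row 2′CD on block-nested placements: a nested block with arbitrary graphs hanging at its cut vertices
(blind cell PercRepro2, mine-a g36; MINE-A.md §91, proofs/MINEA-CD-NESTED.md §6)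

The (AC) transfers of `CDCutAC` composed with the (AC) form of the nested-paths theorem
(`CDNestedAC.ac_of_nested_simple_paths`).  Three class theorems, each for every up-set and every
admissible weight vector, in a finite simple graph (`ends` injective):

* `cd_of_nested_far` — `v` a cut vertex, `a₁, a₂, o` on its near side (or `= v`), `a₃` beyond it; the
  simple `a₁–v` paths avoiding `a₂` pairwise comparable.  The far side (everything hanging at `v`
  away from `a₁, a₂, o`, with `a₃` anywhere in it) is ARBITRARY.
* `cd_of_nested_root` — `y` a cut vertex, `a₁` on its near side (or `= y`), `a₂, o` beyond it, `a₃`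
  beyond it or `= y`; the simple `y–a₃` paths avoiding `a₂` pairwise comparable.  The near side
  (everything hanging at `y` on `a₁`'s side) is arbitrary.
* `cd_of_nested_between` — two cut vertices `y`, `v`: `a₁` beyond `y`, `a₃` beyond `v`, `a₂, o` in the
  block between them whose simple `y–v` paths avoiding `a₂` are pairwise comparable; both outer sides
  arbitrary.  (A series composition: the row only sees the block that carries `a₂` and `o`.)

The comparability hypotheses are stated for the simple paths of the whole graph: a simple path between
two vertices of one side cannot use an edge of the other side (it would have to pass the cut vertex
twice).  A placement with `a₂` and `o` on different sides of a cut separating `a₁` from `a₃` has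
`Q ∩ e ∩ f = ∅` and is trivial (`CDCutO.cd_of_ef_empty`).  No definition; one seat.
-/

namespace Summit.Ventures.PercRepro2

namespace CDBlockNested

section Main

variable {V : Type*} {E : Type*} [Fintype E] [DecidableEq E] [Fintype V] [DecidableEq V]
  {R : Type*} [Field R] [LinearOrder R] [IsStrictOrderedRing R]

variable {ends : E → Sym2 V} {VA VB : Set V} {EA EB : Set E} [DecidablePred (· ∈ EA)]
  [DecidablePred (· ∈ EB)]

/-- **Row 2′CD with `a₃` beyond a cut vertex `v` of a nested placement `(a₁, a₂, v)`**: the simple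
`a₁–v` paths avoiding `a₂` are pairwise comparable, `a₁, a₂, o ∈ VA ∪ {v}`, `a₃ ∈ VB` — the far side is
arbitrary. -/
theorem cd_of_nested_far (p : E → R) (hp : IsProbVec p) (hinj : Function.Injective ends) {v : V}
    (h : CutV.IsCut ends v VA VB EA EB) {a₁ a₂ a₃ o : V} (ha₁ : a₁ ∈ VA ∪ {v})
    (ha₂ : a₂ ∈ VA ∪ {v}) (ho : o ∈ VA ∪ {v}) (ha₃ : a₃ ∈ VB) {𝓔 : Set (Set V)}
    (h𝓔 : IsUpperSet 𝓔)
    (hchain : ∀ P P' : (openGraph ends (fun _ => true)).Path a₁ v,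
      a₂ ∉ P.1.support → a₂ ∉ P'.1.support →
      P.1.support.toFinset ⊆ P'.1.support.toFinset ∨ P'.1.support.toFinset ⊆ P.1.support.toFinset) :
    let Q := (connEvent ends a₁ a₂)ᶜ
    let U := clusterInEvent ends a₁ 𝓔
    let e := connEvent ends a₁ a₃
    let f := connEvent ends a₂ o
    let N := (connEvent ends a₁ a₃)ᶜ ∩ (connEvent ends a₂ a₃)ᶜ
    let oU := connEvent ends a₁ o ∪ connEvent ends a₂ o
    prob p (Q ∩ N) * (prob p Q * prob p (Q ∩ U ∩ e ∩ f) - prob p (Q ∩ U) * prob p (Q ∩ e ∩ f)) ≤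
      prob p (Q ∩ N ∩ oU) * (prob p Q * prob p (Q ∩ U ∩ e) - prob p (Q ∩ U) * prob p (Q ∩ e)) :=
  CDCutAC.cd_of_cut_far p hp h ha₁ ha₂ ho ha₃ h𝓔 fun _ h𝓤 =>
    CDNestedAC.ac_of_nested_simple_paths _ (CDCutVertex.isProbVec_zeroOff hp EA) hinj h𝓤 hchain

/-- **Row 2′CD with `a₁` beyond a cut vertex `y` of a nested placement `(y, a₂, a₃)`**: the simple
`y–a₃` paths avoiding `a₂` are pairwise comparable, `a₁ ∈ VA ∪ {y}`, `a₂, o ∈ VB`, `a₃ ∈ VB ∪ {y}` — the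
near side is arbitrary. -/
theorem cd_of_nested_root (p : E → R) (hp : IsProbVec p) (hinj : Function.Injective ends) {y : V}
    (h : CutV.IsCut ends y VA VB EA EB) {a₁ a₂ a₃ o : V} (ha₁ : a₁ ∈ VA ∪ {y}) (ha₂ : a₂ ∈ VB)
    (ho : o ∈ VB) (ha₃ : a₃ ∈ VB ∪ {y}) {𝓔 : Set (Set V)} (h𝓔 : IsUpperSet 𝓔)
    (hchain : ∀ P P' : (openGraph ends (fun _ => true)).Path y a₃,
      a₂ ∉ P.1.support → a₂ ∉ P'.1.support →
      P.1.support.toFinset ⊆ P'.1.support.toFinset ∨ P'.1.support.toFinset ⊆ P.1.support.toFinset) :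
    let Q := (connEvent ends a₁ a₂)ᶜ
    let U := clusterInEvent ends a₁ 𝓔
    let e := connEvent ends a₁ a₃
    let f := connEvent ends a₂ o
    let N := (connEvent ends a₁ a₃)ᶜ ∩ (connEvent ends a₂ a₃)ᶜ
    let oU := connEvent ends a₁ o ∪ connEvent ends a₂ o
    prob p (Q ∩ N) * (prob p Q * prob p (Q ∩ U ∩ e ∩ f) - prob p (Q ∩ U) * prob p (Q ∩ e ∩ f)) ≤
      prob p (Q ∩ N ∩ oU) * (prob p Q * prob p (Q ∩ U ∩ e) - prob p (Q ∩ U) * prob p (Q ∩ e)) :=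
  CDCutAC.cd_of_cut_root p hp h ha₁ ha₂ ho ha₃ h𝓔 fun _ h𝓤 =>
    CDNestedAC.ac_of_nested_simple_paths _ (CDCutVertex.isProbVec_zeroOff hp EB) hinj h𝓤 hchain

/-- **Row 2′CD on a series composition: `a₁` beyond the cut vertex `y`, `a₃` beyond the cut vertex `v`,
`a₂` and `o` in the nested block between them.**  `h` is the cut at `y` (near side `VA ∋ a₁`, far side
`VB ∋ a₂, o, a₃`), `h'` the cut at `v` (near side `VA' ∋ y, a₂, o`, far side `VB' ∋ a₃`); the simple
`y–v` paths avoiding `a₂` are pairwise comparable.  Both outer sides are arbitrary. -/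
theorem cd_of_nested_between (p : E → R) (hp : IsProbVec p) (hinj : Function.Injective ends)
    {y v : V} (h : CutV.IsCut ends y VA VB EA EB) {VA' VB' : Set V} {EA' EB' : Set E}
    [DecidablePred (· ∈ EA')] [DecidablePred (· ∈ EB')] (h' : CutV.IsCut ends v VA' VB' EA' EB')
    {a₁ a₂ a₃ o : V} (ha₁ : a₁ ∈ VA ∪ {y}) (ha₂ : a₂ ∈ VB) (ho : o ∈ VB) (ha₃ : a₃ ∈ VB)
    (hy : y ∈ VA' ∪ {v}) (ha₂' : a₂ ∈ VA' ∪ {v}) (ho' : o ∈ VA' ∪ {v}) (ha₃' : a₃ ∈ VB')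
    {𝓔 : Set (Set V)} (h𝓔 : IsUpperSet 𝓔)
    (hchain : ∀ P P' : (openGraph ends (fun _ => true)).Path y v,
      a₂ ∉ P.1.support → a₂ ∉ P'.1.support →
      P.1.support.toFinset ⊆ P'.1.support.toFinset ∨ P'.1.support.toFinset ⊆ P.1.support.toFinset) :
    let Q := (connEvent ends a₁ a₂)ᶜ
    let U := clusterInEvent ends a₁ 𝓔
    let e := connEvent ends a₁ a₃
    let f := connEvent ends a₂ o
    let N := (connEvent ends a₁ a₃)ᶜ ∩ (connEvent ends a₂ a₃)ᶜ
    let oU := connEvent ends a₁ o ∪ connEvent ends a₂ o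
    prob p (Q ∩ N) * (prob p Q * prob p (Q ∩ U ∩ e ∩ f) - prob p (Q ∩ U) * prob p (Q ∩ e ∩ f)) ≤
      prob p (Q ∩ N ∩ oU) * (prob p Q * prob p (Q ∩ U ∩ e) - prob p (Q ∩ U) * prob p (Q ∩ e)) :=
  CDCutAC.cd_of_cut_root p hp h ha₁ ha₂ ho (Or.inl ha₃) h𝓔 fun _ h𝓤 =>
    CDCutAC.required_anticorr_of_cut_far _ (CDCutVertex.isProbVec_zeroOff hp EB) h' hy ha₂' ho' ha₃'
      h𝓤 fun _ h𝓤' =>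
        CDNestedAC.ac_of_nested_simple_paths _
          (CDCutVertex.isProbVec_zeroOff (CDCutVertex.isProbVec_zeroOff hp EB) EA') hinj h𝓤' hchain

end Main

end CDBlockNested

end Summit.Ventures.PercRepro2
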